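import Literature.Computability.AlgebraicComplexity.RazElusiveGeneralRoute
import Mathlib.Data.Finsupp.Fin
import HarnessLib

/-!
# Lexicographic unranking of degree-`r` monomials (for Raz's monomial-description circuit)

Pure combinatorics behind step 1 of the proof of Raz (2010), Prop. 3.6 / 5.5 (p. 160: a circuit
that "generates a description of the monomial `h⁻¹(j) ∈ M`" from the bits of `j`, `h : M → [m]` the
lexicographic order of the degree-`r` monomials in `z₁, …, zₙ`, `m = C(n+r-1, r)`; the tree's
`lexMonomial`, `RazElusiveGeneralRoute.lean`). Unranking in a lexicographic order is done by
counting the completions of a prefix (Kreher–Stinson 2020, §2.3.1, Algorithms 2.7–2.8 for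
`k`-subsets; here for multisets of size `r`, i.e. exponent vectors of degree `r`, in the
`Finsupp.Lex` order of the tree's `lexMonomial`):

* `N(a, d) = |M|` is Mathlib's `Nat.multichoose a d = C(a+d-1, d)`
  (`multichoose_eq_card_degreeMonomials`); `offs n r c = ∑_{c'<c} N(n, r-c')`, the
  rank offset of the block "first exponent `= c`"; `firstExp`, the first exponent of the `j`-th
  monomial; the block-greedy vector `unrankVec` and
  `lexMonomial_eq_unrankVec : h⁻¹(j) = unrankVec n r j` (membership `unrankVec_mem`, strict
  monotonicity `unrankVec_strictMonoOn`, uniqueness of order embeddings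
  `Finset.orderEmbOfFin_unique`);
* the recursion unrolled along the blocks (`lev`, `expo`, `unrankVec_apply`, `sum_expo_eq`);
* the **bit-greedy trajectory** on star/bar strings of length `n + r - 1` — the recursion a
  circuit executes position by position: threshold `tailCount Ls p q = C(Ls-1-p, q)` (completions after
  a bar), step `bstep`, `traj`, the emitted bit `starAt` — and its block structure:
  `traj_bstart`, `traj_block`, `starAt_block`, `starAt_blockEnd`, `exists_block`, `starAt_iff`;
* the read-out used by the circuit: with `hot a` the block of the `a`-th star,
  `star_iff_hot` (position `a + b` carries a star with `r - a` stars remaining iff `b = hot a`) and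
  `sum_single_hot : ∑_{a<r} e_{hot a} = unrankVec n r j`; bounds `traj_fst_le`, `traj_snd_le`,
  `one_le_snd_of_starAt`.

## References

* R. Raz, *Elusive functions and lower bounds for arithmetic circuits*, Theory of Computing 6
  (2010) 135–177, §5.1 (p. 168, the bijection `h`), proof of Prop. 3.6, step 1 (p. 160).
* D. L. Kreher, D. R. Stinson, *Combinatorial Algorithms: Generation, Enumeration, and Search*,
  CRC Press (2020 printing), §2.3.1, Algorithms 2.7 (`KSUBSETLEXRANK`) and 2.8
  (`KSUBSETLEXUNRANK`), with the counting lemma preceding them.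
-/

noncomputable section


open Finset

namespace Literature.Computability.AlgebraicComplexity

namespace LexUnrank

/-- `N(a, d) = |M|`: Mathlib's `Nat.multichoose a d = C(a+d-1, d)` is the number of degree-`d`
monomials in `a` variables (stars and bars; `card_degreeMonomials` of the tree, cf. Mathlib's
`Finset.card_finsuppAntidiag_nat_eq_multichoose`). [cite: Raz2010, §5.1 (p. 168)] -/
theorem multichoose_eq_card_degreeMonomials (a d : ℕ) :
    Nat.multichoose a d = (degreeMonomials a d).card := by
  rw [Nat.multichoose_eq, card_degreeMonomials]

/-- `N(a + 1, d) = C(a + d, d)`. [folklore] -/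
theorem multichoose_succ_left (a d : ℕ) : Nat.multichoose (a + 1) d = Nat.choose (a + d) d := by
  rw [Nat.multichoose_eq, Nat.add_right_comm, Nat.add_sub_cancel]

/-- `offs n r c = ∑_{c' < c} N(n, r - c')`: the number of degree-`r` monomials in `n + 1`
variables whose first exponent is `< c` (for `c ≤ r + 1`). [folklore] -/
def offs (n r c : ℕ) : ℕ := ∑ c' ∈ Finset.range c, Nat.multichoose n (r - c')

/-- `offs n r 0 = 0`. [folklore] -/
@[simp] theorem offs_zero (n r : ℕ) : offs n r 0 = 0 := by simp [offs]

/-- `offs n r (c + 1) = offs n r c + N(n, r - c)`. [folklore] -/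
theorem offs_succ (n r c : ℕ) : offs n r (c + 1) = offs n r c + Nat.multichoose n (r - c) := by
  simp [offs, Finset.sum_range_succ]

/-- `offs n r` is monotone. [folklore] -/
theorem offs_mono (n r : ℕ) : Monotone (offs n r) := fun c c' h => by
  unfold offs
  exact Finset.sum_le_sum_of_subset (Finset.range_subset_range.2 h)

/-- the partition of degree-`r` monomials in `n+1` variables by the first exponent:
`∑_{c ≤ r} N(n, r - c) = N(n + 1, r)`. [folklore] -/
theorem offs_succ_self (n r : ℕ) : offs n r (r + 1) = Nat.multichoose (n + 1) r := by
  rw [multichoose_succ_left]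
  unfold offs
  rcases Nat.eq_zero_or_pos n with rfl | hn
  · -- `n = 0`: only `c = r` contributes
    rw [Finset.sum_range_succ, Nat.sub_self, Nat.multichoose_zero_right, zero_add, Nat.choose_self]
    rw [Finset.sum_eq_zero, zero_add]
    intro c hc
    rw [Finset.mem_range] at hc
    obtain ⟨k, hk⟩ := Nat.exists_eq_add_of_lt hc
    rw [show r - c = k + 1 by omega, Nat.multichoose_zero_succ]
  · -- hockey stick
    obtain ⟨m, rfl⟩ := Nat.exists_eq_add_of_lt hn
    simp only [zero_add] at *
    have h := Nat.sum_range_add_choose r m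
    -- ∑ i ∈ range (r+1), (i + m).choose m = (r + m + 1).choose (m + 1)
    rw [← Finset.sum_range_reflect] at h
    have h2 : ∑ c ∈ Finset.range (r + 1), Nat.multichoose (m + 1) (r - c) =
        ∑ j ∈ Finset.range (r + 1), (r + 1 - 1 - j + m).choose m := by
      refine Finset.sum_congr rfl fun c hc => ?_
      rw [Finset.mem_range] at hc
      rw [multichoose_succ_left, show m + (r - c) = (r - c) + m by ring, Nat.choose_symm_add,
        show r + 1 - 1 - c = r - c by omega]
    rw [h2, h, show r + m + 1 = m + 1 + r by ring, Nat.choose_symm_add]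

/-- the first exponent of the `j`-th monomial: the least `c` with `j < offs n r (c + 1)`
(or `c = r`). [folklore] -/
def firstExp (n r j : ℕ) : ℕ := Nat.find (⟨r, Or.inr rfl⟩ : ∃ c, j < offs n r (c + 1) ∨ c = r)

/-- The first exponent is `≤ r`. [folklore] -/
theorem firstExp_le (n r j : ℕ) : firstExp n r j ≤ r :=
  Nat.find_le (Or.inr rfl)

/-- Minimality: the offset of the chosen block is `≤ j`. [folklore] -/
theorem offs_firstExp_le (n r j : ℕ) : offs n r (firstExp n r j) ≤ j := by
  rcases Nat.eq_zero_or_pos (firstExp n r j) with h | h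
  · rw [h, offs_zero]; exact Nat.zero_le _
  · obtain ⟨c, hc⟩ := Nat.exists_eq_add_of_lt h
    rw [zero_add] at hc
    have hmin := Nat.find_min (⟨r, Or.inr rfl⟩ : ∃ c, j < offs n r (c + 1) ∨ c = r)
      (show c < firstExp n r j by rw [hc]; exact Nat.lt_succ_self c)
    rw [not_or, not_lt] at hmin
    rw [hc]; exact hmin.1

/-- For `j` in range, `j` lies below the end of the chosen block. [folklore] -/
theorem lt_offs_firstExp_succ {n r j : ℕ} (hj : j < Nat.multichoose (n + 1) r) :
    j < offs n r (firstExp n r j + 1) := by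
  rcases Nat.find_spec (⟨r, Or.inr rfl⟩ : ∃ c, j < offs n r (c + 1) ∨ c = r) with h | h
  · exact h
  · unfold firstExp; rw [h, offs_succ_self]; exact hj

/-- The residual index is in range for the tail problem. [folklore] -/
theorem sub_offs_lt {n r j : ℕ} (hj : j < Nat.multichoose (n + 1) r) :
    j - offs n r (firstExp n r j) < Nat.multichoose n (r - firstExp n r j) := by
  have h1 := lt_offs_firstExp_succ hj
  have h2 := offs_firstExp_le n r j
  rw [offs_succ] at h1
  omega

/-- The first exponent is monotone in the index. [folklore] -/
theorem firstExp_mono (n r : ℕ) : Monotone (firstExp n r) := fun j₁ j₂ h => by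
  unfold firstExp
  exact Nat.find_mono fun c hc => hc.imp_left fun h' => lt_of_le_of_lt h h'

/-- **Block-greedy unranking** of the `j`-th degree-`r` monomial in `n` variables
(lexicographic order, first exponent most significant, smaller first). [folklore] -/
def unrankVec : (n r j : ℕ) → (Fin n →₀ ℕ)
  | 0, _, _ => 0
  | n + 1, r, j => Finsupp.cons (firstExp n r j)
      (unrankVec n (r - firstExp n r j) (j - offs n r (firstExp n r j)))

/-- Unfolding `unrankVec` at `n + 1`. [folklore] -/
theorem unrankVec_succ (n r j : ℕ) : unrankVec (n + 1) r j = Finsupp.cons (firstExp n r j)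
    (unrankVec n (r - firstExp n r j) (j - offs n r (firstExp n r j))) := rfl

/-- `∑ᵢ (cons y s)ᵢ = y + ∑ᵢ sᵢ`. [folklore] -/
theorem sum_cons {n : ℕ} (y : ℕ) (s : Fin n →₀ ℕ) : ∑ i, Finsupp.cons y s i = y + ∑ i, s i := by
  rw [Fin.sum_univ_succ]
  simp [Finsupp.cons_zero, Finsupp.cons_succ]

/-- the unranked vector has degree `r` (for `j` in range). [folklore] -/
theorem unrankVec_mem : ∀ (n r j : ℕ), j < Nat.multichoose n r → unrankVec n r j ∈ degreeMonomials n r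
  | 0, r, j, hj => by
    rcases r with _ | r
    · rw [mem_degreeMonomials]; simp [unrankVec]
    · rw [Nat.multichoose_zero_succ] at hj; exact absurd hj (Nat.not_lt_zero _)
  | n + 1, r, j, hj => by
    rw [mem_degreeMonomials, unrankVec_succ, sum_cons]
    have ih := unrankVec_mem n (r - firstExp n r j) (j - offs n r (firstExp n r j)) (sub_offs_lt hj)
    rw [mem_degreeMonomials] at ih
    rw [ih]
    have := firstExp_le n r j
    omega

/-- lifting a strict inequality along `cons` with equal heads [folklore] -/
theorem toLex_cons_lt_cons {n : ℕ} (y : ℕ) {s t : Fin n →₀ ℕ} (h : toLex s < toLex t) :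
    toLex (Finsupp.cons y s) < toLex (Finsupp.cons y t) := by
  rw [Finsupp.Lex.lt_iff] at h ⊢
  obtain ⟨i, hi, hlt⟩ := h
  refine ⟨i.succ, fun j hj => ?_, ?_⟩
  · rcases Fin.eq_zero_or_eq_succ j with rfl | ⟨j', rfl⟩
    · show Finsupp.cons y s 0 = Finsupp.cons y t 0
      rw [Finsupp.cons_zero, Finsupp.cons_zero]
    · show Finsupp.cons y s j'.succ = Finsupp.cons y t j'.succ
      rw [Finsupp.cons_succ, Finsupp.cons_succ]
      exact hi j' (Fin.succ_lt_succ_iff.1 hj)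
  · show Finsupp.cons y s i.succ < Finsupp.cons y t i.succ
    rw [Finsupp.cons_succ, Finsupp.cons_succ]; exact hlt

/-- A smaller head gives a lexicographically smaller vector. [folklore] -/
theorem toLex_cons_lt_cons_of_lt {n : ℕ} {y y' : ℕ} (s t : Fin n →₀ ℕ) (h : y < y') :
    toLex (Finsupp.cons y s) < toLex (Finsupp.cons y' t) := by
  rw [Finsupp.Lex.lt_iff]
  refine ⟨0, fun j hj => absurd hj (Fin.not_lt_zero j), ?_⟩
  show Finsupp.cons y s 0 < Finsupp.cons y' t 0
  rw [Finsupp.cons_zero, Finsupp.cons_zero]; exact h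

/-- **strict monotonicity** of block-greedy unranking on `j < N(n, r)` [folklore] -/
theorem unrankVec_strictMonoOn : ∀ (n r : ℕ) {j₁ j₂ : ℕ}, j₁ < j₂ → j₂ < Nat.multichoose n r →
    toLex (unrankVec n r j₁) < toLex (unrankVec n r j₂)
  | 0, r, j₁, j₂, h12, h2 => by
    rcases r with _ | r
    · rw [Nat.multichoose_zero_right] at h2; omega
    · rw [Nat.multichoose_zero_succ] at h2; exact absurd h2 (Nat.not_lt_zero _)
  | n + 1, r, j₁, j₂, h12, h2 => by
    rw [unrankVec_succ, unrankVec_succ]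
    have hcle : firstExp n r j₁ ≤ firstExp n r j₂ := firstExp_mono n r h12.le
    rcases hcle.lt_or_eq with hlt | heq
    · exact toLex_cons_lt_cons_of_lt _ _ hlt
    · rw [heq]
      refine toLex_cons_lt_cons _ (unrankVec_strictMonoOn n _ ?_ (sub_offs_lt h2))
      have := offs_firstExp_le n r j₁
      rw [heq] at this
      omega

/-- **The lexicographic enumeration is block-greedy unranking**: `h⁻¹(j) = unrankVec n r j`.
[folklore] -/
theorem lexMonomial_eq_unrankVec (n r : ℕ) (j : Fin (Nat.choose (n + r - 1) r)) :
    lexMonomial n r j = unrankVec n r j := by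
  have hcard := card_degreeMonomialsLex n r
  have hlt : ∀ i : Fin (Nat.choose (n + r - 1) r), (i : ℕ) < Nat.multichoose n r := fun i => by
    rw [Nat.multichoose_eq]; exact i.isLt
  have key := Finset.orderEmbOfFin_unique hcard
    (f := fun j : Fin (Nat.choose (n + r - 1) r) => toLex (unrankVec n r j))
    (fun j => mem_degreeMonomialsLex.2 (by simpa using unrankVec_mem n r j (hlt j)))
    (fun j₁ j₂ h => unrankVec_strictMonoOn n r h (hlt j₂))
  have := congrFun key j
  rw [lexMonomial, ← this, ofLex_toLex]

/-! ### Levels: the block-greedy recursion unrolled -/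

/-- `lev n r j b = (q_b, j_b)`: remaining degree and index when block `b` starts. [folklore] -/
def lev (n r j : ℕ) : ℕ → ℕ × ℕ
  | 0 => (r, j)
  | b + 1 => ((lev n r j b).1 - firstExp (n - 1 - b) (lev n r j b).1 (lev n r j b).2,
      (lev n r j b).2 - offs (n - 1 - b) (lev n r j b).1 (firstExp (n - 1 - b) (lev n r j b).1 (lev n r j b).2))

/-- the exponent chosen in block `b` [folklore] -/
def expo (n r j b : ℕ) : ℕ := firstExp (n - 1 - b) (lev n r j b).1 (lev n r j b).2

/-- Level `0` is `(r, j)`. [folklore] -/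
theorem lev_zero (n r j : ℕ) : lev n r j 0 = (r, j) := rfl

/-- Unfolding one level. [folklore] -/
theorem lev_succ (n r j b : ℕ) : lev n r j (b + 1) =
    ((lev n r j b).1 - expo n r j b, (lev n r j b).2 - offs (n - 1 - b) (lev n r j b).1 (expo n r j b)) :=
  rfl

/-- shifting: the levels of the tail problem [folklore] -/
theorem lev_succ_shift (n r j b : ℕ) :
    lev (n + 1) r j (b + 1) = lev n (r - firstExp n r j) (j - offs n r (firstExp n r j)) b := by
  induction b with
  | zero => simp [lev]
  | succ b ih =>
    rw [lev_succ (n + 1) r j (b + 1), lev_succ n _ _ b, expo, expo, ih,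
      show n + 1 - 1 - (b + 1) = n - 1 - b by omega]

/-- The exponents of the tail problem are the shifted exponents. [folklore] -/
theorem expo_succ_shift (n r j b : ℕ) :
    expo (n + 1) r j (b + 1) = expo n (r - firstExp n r j) (j - offs n r (firstExp n r j)) b := by
  rw [expo, expo, lev_succ_shift, show n + 1 - 1 - (b + 1) = n - 1 - b by omega]

/-- the coordinates of the block-greedy vector are the chosen exponents [folklore] -/
theorem unrankVec_apply : ∀ (n r j : ℕ) (b : Fin n), unrankVec n r j b = expo n r j b
  | 0, _, _, b => b.elim0
  | n + 1, r, j, b => by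
    rw [unrankVec_succ]
    refine Fin.cases ?_ (fun b' => ?_) b
    · rw [Finsupp.cons_zero]; rfl
    · rw [Finsupp.cons_succ, unrankVec_apply n _ _ b', Fin.val_succ, expo_succ_shift]

/-- the index invariant `j_b < N(n - b, q_b)` [folklore] -/
theorem lev_lt : ∀ (b : ℕ) {n r j : ℕ}, b ≤ n → j < Nat.multichoose n r →
    (lev n r j b).2 < Nat.multichoose (n - b) (lev n r j b).1
  | 0, n, r, j, _, hj => by simpa [lev] using hj
  | b + 1, n, r, j, hb, hj => by
    obtain ⟨n', rfl⟩ : ∃ n', n = n' + 1 := ⟨n - 1, by omega⟩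
    rw [lev_succ_shift, show n' + 1 - (b + 1) = n' - b by omega]
    exact lev_lt b (by omega) (sub_offs_lt hj)

/-- `q_b ≤ r` decreases: `q_{b+1} = q_b - c_b`, `c_b ≤ q_b` [folklore] -/
theorem expo_le (n r j b : ℕ) : expo n r j b ≤ (lev n r j b).1 := firstExp_le _ _ _

/-- `q_b ≤ r`. [folklore] -/
theorem lev_fst_le (n r j : ℕ) : ∀ b, (lev n r j b).1 ≤ r
  | 0 => le_rfl
  | b + 1 => by rw [lev_succ]; exact (Nat.sub_le _ _).trans (lev_fst_le n r j b)

/-- prefix sums of exponents: `r - q_b = ∑_{b' < b} c_{b'}` [folklore] -/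
theorem sum_expo_eq (n r j : ℕ) : ∀ b, ∑ b' ∈ Finset.range b, expo n r j b' = r - (lev n r j b).1
  | 0 => by simp [lev]
  | b + 1 => by
    rw [Finset.sum_range_succ, sum_expo_eq n r j b, lev_succ]
    have h1 := expo_le n r j b
    have h2 := lev_fst_le n r j b
    simp only
    omega

/-! ### The bit-greedy trajectory (the circuit's recursion) -/

/-- threshold: completions when a bar is placed at position `p` with `q` stars left,
string length `Ls` [folklore] -/
def tailCount (Ls p q : ℕ) : ℕ := Nat.choose (Ls - 1 - p) q

/-- one step of bit-greedy unranking: state `(R, q)` [folklore] -/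
def bstep (Ls p : ℕ) (st : ℕ × ℕ) : ℕ × ℕ :=
  if tailCount Ls p st.2 ≤ st.1 then (st.1 - tailCount Ls p st.2, st.2 - 1) else st

/-- the trajectory from `(j, r)` [folklore] -/
def traj (Ls r j : ℕ) : ℕ → ℕ × ℕ
  | 0 => (j, r)
  | p + 1 => bstep Ls p (traj Ls r j p)

/-- the emitted bit (star = `true`) at position `p` [folklore] -/
def starAt (Ls r j p : ℕ) : Bool := decide (tailCount Ls p (traj Ls r j p).2 ≤ (traj Ls r j p).1)

/-- Unfolding one step of the trajectory. [folklore] -/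
theorem traj_succ (Ls r j p : ℕ) : traj Ls r j (p + 1) = bstep Ls p (traj Ls r j p) := rfl

/-- start position of block `b`: `b` bars and `r - q_b` stars before it [folklore] -/
def bstart (n r j b : ℕ) : ℕ := b + (r - (lev n r j b).1)

variable {n r j : ℕ}

/-- the threshold inside block `b` is a monomial count [folklore] -/
theorem tailCount_block {b t : ℕ} (hb : b < n) (ht : t ≤ (lev n r j b).1) :
    tailCount (n + r - 1) (bstart n r j b + t) ((lev n r j b).1 - t) = Nat.multichoose (n - 1 - b) ((lev n r j b).1 - t) := by
  unfold tailCount bstart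
  rw [Nat.multichoose_eq]
  have hq := lev_fst_le n r j b
  congr 1
  omega

/-- **Block lemma (inside block `b`)**: for `t ≤ c_b`, the trajectory at position
`bstart b + t` is `(j_b - offs t, q_b - t)`. [folklore] -/
theorem traj_block {b : ℕ} (hb : b < n) (hj : j < Nat.multichoose n r)
    (hstart : traj (n + r - 1) r j (bstart n r j b) = ((lev n r j b).2, (lev n r j b).1)) :
    ∀ t, t ≤ expo n r j b →
      traj (n + r - 1) r j (bstart n r j b + t) =
        ((lev n r j b).2 - offs (n - 1 - b) (lev n r j b).1 t, (lev n r j b).1 - t)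
  | 0, _ => by rw [Nat.add_zero, hstart, offs_zero, Nat.sub_zero, Nat.sub_zero]
  | t + 1, ht => by
    have hc := expo_le n r j b
    rw [← Nat.add_assoc, traj_succ, traj_block hb hj hstart t (Nat.le_of_succ_le ht)]
    unfold bstep
    simp only
    rw [tailCount_block hb (by omega)]
    have h1 : offs (n - 1 - b) (lev n r j b).1 (t + 1) ≤ (lev n r j b).2 :=
      (offs_mono _ _ ht).trans (offs_firstExp_le _ _ _)
    rw [offs_succ] at h1
    rw [if_pos (by omega), offs_succ]
    ext <;> simp only <;> omega

/-- at the end of a non-final block a bar is emitted and the state is kept [folklore] -/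
theorem starAt_blockEnd {b : ℕ} (hb : b < n) (hj : j < Nat.multichoose n r)
    (hstart : traj (n + r - 1) r j (bstart n r j b) = ((lev n r j b).2, (lev n r j b).1)) :
    starAt (n + r - 1) r j (bstart n r j b + expo n r j b) = false := by
  have hc := expo_le n r j b
  unfold starAt
  rw [traj_block hb hj hstart _ le_rfl]
  simp only
  rw [tailCount_block hb hc, decide_eq_false_iff_not, not_le]
  have h1 := lt_offs_firstExp_succ (n := n - 1 - b) (r := (lev n r j b).1) (j := (lev n r j b).2)
    (by rw [show n - 1 - b + 1 = n - b by omega]; exact lev_lt b hb.le hj)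
  rw [offs_succ] at h1
  change (lev n r j b).2 < offs (n - 1 - b) (lev n r j b).1 (expo n r j b) +
    Nat.multichoose (n - 1 - b) ((lev n r j b).1 - expo n r j b) at h1
  have h2 : offs (n - 1 - b) (lev n r j b).1 (expo n r j b) ≤ (lev n r j b).2 :=
    offs_firstExp_le _ _ _
  omega

/-- inside a block stars are emitted [folklore] -/
theorem starAt_block {b : ℕ} (hb : b < n) (hj : j < Nat.multichoose n r)
    (hstart : traj (n + r - 1) r j (bstart n r j b) = ((lev n r j b).2, (lev n r j b).1))
    {t : ℕ} (ht : t < expo n r j b) :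
    starAt (n + r - 1) r j (bstart n r j b + t) = true := by
  have hc := expo_le n r j b
  unfold starAt
  rw [traj_block hb hj hstart t ht.le]
  simp only
  rw [tailCount_block hb (by omega), decide_eq_true_iff]
  have h1 : offs (n - 1 - b) (lev n r j b).1 (t + 1) ≤ (lev n r j b).2 :=
    (offs_mono _ _ ht).trans (offs_firstExp_le _ _ _)
  rw [offs_succ] at h1
  omega

/-- block starts: `bstart (b+1) = bstart b + c_b + 1` [folklore] -/
theorem bstart_succ (b : ℕ) : bstart n r j (b + 1) = bstart n r j b + expo n r j b + 1 := by
  unfold bstart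
  rw [lev_succ]
  have h1 := expo_le n r j b
  have h2 := lev_fst_le n r j b
  simp only
  omega

/-- Block `0` starts at position `0`. [folklore] -/
@[simp] theorem bstart_zero : bstart n r j 0 = 0 := by simp [bstart, lev]

/-- **the trajectory passes through the block starts with the levels as states** [folklore] -/
theorem traj_bstart (hj : j < Nat.multichoose n r) : ∀ {b : ℕ}, b < n →
    traj (n + r - 1) r j (bstart n r j b) = ((lev n r j b).2, (lev n r j b).1)
  | 0, _ => by simp [bstart, lev, traj]
  | b + 1, hb => by
    have hb' : b < n := Nat.lt_of_succ_lt hb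
    have hstart := traj_bstart hj hb'
    rw [bstart_succ, traj_succ, traj_block hb' hj hstart _ le_rfl]
    -- the bar step keeps the state
    have hbar := starAt_blockEnd hb' hj hstart
    unfold starAt at hbar
    rw [traj_block hb' hj hstart _ le_rfl, decide_eq_false_iff_not] at hbar
    unfold bstep
    rw [if_neg hbar, lev_succ, expo]



/-- `q_n = 0`: all `r` stars are used (`∑_b c_b = r`) [folklore] -/
theorem lev_fst_n (hj : j < Nat.multichoose n r) : (lev n r j n).1 = 0 := by
  have h1 := sum_expo_eq n r j n
  have h2 : ∑ b ∈ Finset.range n, expo n r j b = r := by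
    have hm := unrankVec_mem n r j hj
    rw [mem_degreeMonomials] at hm
    refine Eq.trans ?_ hm
    rw [← Fin.sum_univ_eq_sum_range]
    exact Finset.sum_congr rfl fun b _ => (unrankVec_apply n r j b).symm
  have h3 := lev_fst_le n r j n
  omega

/-- `bstart n = n + r` (one past the end `Ls = n + r - 1`) [folklore] -/
theorem bstart_n (hj : j < Nat.multichoose n r) : bstart n r j n = n + r := by
  rw [bstart, lev_fst_n hj]; omega

/-- Block starts are monotone. [folklore] -/
theorem bstart_mono : Monotone (bstart n r j) :=
  monotone_nat_of_le_succ fun b => by rw [bstart_succ]; omega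

/-- Block starts are strictly monotone. [folklore] -/
theorem bstart_strictMono : StrictMono (bstart n r j) :=
  strictMono_nat_of_lt_succ fun b => by rw [bstart_succ]; omega

/-- **covering**: every position `p < n + r - 1` lies in a block `b < n` at an offset
`t ≤ c_b`, and `t = c_b` only for a non-final block [folklore] -/
theorem exists_block (hj : j < Nat.multichoose n r) {p : ℕ} (hp : p < n + r - 1) :
    ∃ b t, b < n ∧ t ≤ expo n r j b ∧ p = bstart n r j b + t ∧ (t = expo n r j b → b + 1 < n) := by
  classical
  -- the last block start `≤ p`
  let b := Nat.findGreatest (fun b => bstart n r j b ≤ p) n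
  have hb : bstart n r j b ≤ p := Nat.findGreatest_spec (P := fun b => bstart n r j b ≤ p)
    (Nat.zero_le n) (by simp)
  have hbn : b ≤ n := Nat.findGreatest_le n
  have hlt : b < n := by
    rcases hbn.lt_or_eq with h | h
    · exact h
    · exfalso; rw [h, bstart_n hj] at hb; omega
  have hnext : p < bstart n r j (b + 1) := by
    by_contra hcon
    rw [not_lt] at hcon
    have := Nat.le_findGreatest (P := fun b => bstart n r j b ≤ p) (Nat.succ_le_of_lt hlt) hcon
    change b + 1 ≤ b at this
    omega
  rw [bstart_succ] at hnext
  refine ⟨b, p - bstart n r j b, hlt, by omega, by omega, fun ht => ?_⟩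
  by_contra hcon
  have hb1 : b + 1 = n := by omega
  have h5 : bstart n r j (b + 1) = n + r := by rw [hb1]; exact bstart_n hj
  rw [bstart_succ] at h5
  omega

/-- **the emitted string**: position `bstart b + t` carries a star iff `t < c_b` [folklore] -/
theorem starAt_iff (hj : j < Nat.multichoose n r) {b t : ℕ} (hb : b < n) (ht : t ≤ expo n r j b) :
    starAt (n + r - 1) r j (bstart n r j b + t) = true ↔ t < expo n r j b := by
  rcases ht.lt_or_eq with h | h
  · exact ⟨fun _ => h, fun _ => starAt_block hb hj (traj_bstart hj hb) h⟩
  · rw [h, starAt_blockEnd hb hj (traj_bstart hj hb)]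
    simp

/-- the remaining-stars count at a star position [folklore] -/
theorem traj_snd_block (hj : j < Nat.multichoose n r) {b t : ℕ} (hb : b < n) (ht : t ≤ expo n r j b) :
    (traj (n + r - 1) r j (bstart n r j b + t)).2 = (lev n r j b).1 - t := by
  rw [traj_block hb hj (traj_bstart hj hb) t ht]

/-! ### The description: star `a` lies in block `hot a` -/

/-- stars before block `b`: `S b = r - q_b = ∑_{b' < b} c_{b'}` [folklore] -/
def spre (n r j b : ℕ) : ℕ := r - (lev n r j b).1

/-- No stars before block `0`. [folklore] -/
theorem spre_zero : spre n r j 0 = 0 := by simp [spre, lev]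

/-- `S (b + 1) = S b + c_b`. [folklore] -/
theorem spre_succ (b : ℕ) : spre n r j (b + 1) = spre n r j b + expo n r j b := by
  unfold spre; rw [lev_succ]
  have h1 := expo_le n r j b
  have h2 := lev_fst_le n r j b
  simp only; omega

/-- `S` is monotone. [folklore] -/
theorem spre_mono : Monotone (spre n r j) :=
  monotone_nat_of_le_succ fun b => by rw [spre_succ]; omega

/-- `S n = r`: all stars are used. [folklore] -/
theorem spre_n (hj : j < Nat.multichoose n r) : spre n r j n = r := by
  rw [spre, lev_fst_n hj]; omega

/-- `bstart b = b + S b`. [folklore] -/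
theorem bstart_eq (b : ℕ) : bstart n r j b = b + spre n r j b := rfl

/-- the block of the `a`-th star: the largest `b ≤ n` with `S b ≤ a` [folklore] -/
def hot (n r j a : ℕ) : ℕ := Nat.findGreatest (fun b => spre n r j b ≤ a) n

/-- Characterisation of the block of star `a`: `hot a = b ↔ S b ≤ a < S (b + 1)`. [folklore] -/
theorem hot_eq_iff {a b : ℕ} (hb : b < n) :
    hot n r j a = b ↔ spre n r j b ≤ a ∧ a < spre n r j (b + 1) := by
  unfold hot
  rw [Nat.findGreatest_eq_iff]
  constructor
  · rintro ⟨-, h1, h2⟩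
    refine ⟨?_, ?_⟩
    · rcases Nat.eq_zero_or_pos b with rfl | hpos
      · rw [spre_zero]; exact Nat.zero_le _
      · exact h1 hpos.ne'
    · by_contra hcon
      exact h2 (Nat.lt_succ_self b) (Nat.succ_le_of_lt hb) (not_lt.1 hcon)
  · rintro ⟨h1, h2⟩
    refine ⟨hb.le, fun _ => h1, fun b' hbb' _ hle => ?_⟩
    exact absurd (lt_of_lt_of_le h2 ((spre_mono (Nat.succ_le_of_lt hbb')).trans hle)) (lt_irrefl a)

/-- For `a < r`, the block of star `a` is `< n` and contains `a`. [folklore] -/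
theorem hot_spec (hj : j < Nat.multichoose n r) {a : ℕ} (ha : a < r) :
    hot n r j a < n ∧ spre n r j (hot n r j a) ≤ a ∧ a < spre n r j (hot n r j a + 1) := by
  have hle : hot n r j a ≤ n := Nat.findGreatest_le n
  have hlt : hot n r j a < n := by
    rcases hle.lt_or_eq with h | h
    · exact h
    · exfalso
      have := Nat.findGreatest_spec (P := fun b => spre n r j b ≤ a) (Nat.zero_le n)
        (by simp [spre_zero])
      change spre n r j (hot n r j a) ≤ a at this
      rw [h, spre_n hj] at this; omega
  exact ⟨hlt, ((hot_eq_iff hlt).1 rfl)⟩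

/-- **Output characterisation.** For `j < m`, `a < r`, `b < n`: position `a + b` carries a
star with `r - a` stars remaining iff `b = hot a`. [folklore] -/
theorem star_iff_hot (hj : j < Nat.multichoose n r) {a b : ℕ} (ha : a < r) (hb : b < n) :
    (starAt (n + r - 1) r j (a + b) = true ∧ (traj (n + r - 1) r j (a + b)).2 = r - a) ↔
      b = hot n r j a := by
  constructor
  · rintro ⟨hstar, hq⟩
    have hp : a + b < n + r - 1 := by omega
    obtain ⟨b', t, hb', ht, hpt, -⟩ := exists_block hj hp
    have htc : t < expo n r j b' := (starAt_iff hj hb' ht).1 (hpt ▸ hstar)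
    rw [hpt, traj_snd_block hj hb' ht] at hq
    have hq' := lev_fst_le n r j b'
    have hc := expo_le n r j b'
    have ha' : a = spre n r j b' + t := by unfold spre; omega
    rw [bstart_eq] at hpt
    have hbb : b = b' := by omega
    rw [hbb]; symm
    rw [hot_eq_iff hb', spre_succ]
    omega
  · rintro rfl
    obtain ⟨hlt, h1, h2⟩ := hot_spec hj ha
    rw [spre_succ] at h2
    set b := hot n r j a
    have hpos : a + b = bstart n r j b + (a - spre n r j b) := by rw [bstart_eq]; omega
    have ht : a - spre n r j b < expo n r j b := by omega
    rw [hpos]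
    refine ⟨starAt_block hlt hj (traj_bstart hj hlt) ht, ?_⟩
    rw [traj_snd_block hj hlt ht.le]
    have := lev_fst_le n r j b
    unfold spre at h1 ⊢
    unfold spre at ht
    omega

/-- the number of stars in block `b` is `c_b` [folklore] -/
theorem card_filter_hot (hj : j < Nat.multichoose n r) {b : ℕ} (hb : b < n) :
    ((Finset.range r).filter fun a => hot n r j a = b).card = expo n r j b := by
  have h : (Finset.range r).filter (fun a => hot n r j a = b) =
      Finset.Ico (spre n r j b) (spre n r j (b + 1)) := by
    ext a
    rw [Finset.mem_filter, Finset.mem_range, Finset.mem_Ico]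
    constructor
    · rintro ⟨ha, hab⟩; exact (hot_eq_iff hb).1 hab
    · rintro ⟨h1, h2⟩
      have hsn : spre n r j (b + 1) ≤ spre n r j n := spre_mono (Nat.succ_le_of_lt hb)
      rw [spre_n hj] at hsn
      have ha : a < r := lt_of_lt_of_le h2 hsn
      exact ⟨ha, (hot_eq_iff hb).2 ⟨h1, h2⟩⟩
  rw [h, Nat.card_Ico, spre_succ, Nat.add_sub_cancel_left]

/-- **the multiset of blocks of the stars is the exponent vector** `h⁻¹(j)` [folklore] -/
theorem sum_single_hot (hj : j < Nat.multichoose n r) (hotF : ℕ → Fin n)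
    (hhot : ∀ a, a < r → (hotF a : ℕ) = hot n r j a) :
    ∑ a ∈ Finset.range r, Finsupp.single (hotF a) (1 : ℕ) = unrankVec n r j := by
  classical
  ext b
  rw [Finsupp.finsetSum_apply, unrankVec_apply]
  simp only [Finsupp.single_apply]
  rw [Finset.sum_boole, ← card_filter_hot hj b.isLt]
  simp only [Nat.cast_id]
  congr 1
  refine Finset.filter_congr fun a ha => ?_
  rw [Finset.mem_range] at ha
  rw [← hhot a ha]
  exact ⟨fun h => congrArg Fin.val h, fun h => Fin.ext h⟩


/-! ### Trajectory bounds -/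

/-- The remaining index never increases: `R_p ≤ j`. [folklore] -/
theorem traj_fst_le (Ls : ℕ) : ∀ p, (traj Ls r j p).1 ≤ j
  | 0 => le_rfl
  | p + 1 => by
    rw [traj_succ]; unfold bstep
    split
    · exact (Nat.sub_le _ _).trans (traj_fst_le Ls p)
    · exact traj_fst_le Ls p

/-- The remaining degree never increases: `q_p ≤ r`. [folklore] -/
theorem traj_snd_le (Ls : ℕ) : ∀ p, (traj Ls r j p).2 ≤ r
  | 0 => le_rfl
  | p + 1 => by
    rw [traj_succ]; unfold bstep
    split
    · exact (Nat.sub_le _ _).trans (traj_snd_le Ls p)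
    · exact traj_snd_le Ls p

/-- Stars are only emitted while stars remain. [folklore] -/
theorem one_le_snd_of_starAt (hj : j < Nat.multichoose n r) {p : ℕ} (hp : p < n + r - 1)
    (hstar : starAt (n + r - 1) r j p = true) : 1 ≤ (traj (n + r - 1) r j p).2 := by
  obtain ⟨b, t, hb, ht, rfl, -⟩ := exists_block hj hp
  have htc : t < expo n r j b := (starAt_iff hj hb ht).1 hstar
  rw [traj_snd_block hj hb ht]
  have := expo_le n r j b
  omega


end LexUnrank
end Literature.Computability.AlgebraicComplexity

end
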